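import Summits.AnomalousDissipation.AnomalousDissipation.Theorems.FloorCertificate.Negative.WeakDuality

/-!
# Stub `stub_linearLiouville` (D) of the line `Sketch`
# (crux stmt-AnomalousDissipation-14086, `TaylorCertificates.FloorCertificateEnsembleCeiling`)

THE LIOUVILLE EQUATION TESTED WITH A FIXED FIELD. A stationary statistical solution `μ` of
`NS_ν(f)` on `T³` (Foias–Manley–Rosa–Temam 2001, Ch. IV Def. 1.3; tree structure
`Torus.IsStationaryStatisticalSolution ν f μ`) satisfies the Liouville equation
`∫ ⟨F(u), Φ'(u)⟩ dμ = 0` for CYLINDRICAL test functionals `Φ`, whose differential `Φ'(u)`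
depends on `u`. Here we record the LINEAR-TEST case: for `ν > 0`, `f ∈ L²` and a FIXED smooth
solenoidal mean-zero field `w`, the map `u ↦ ⟨F(u), w⟩ = (f, w) + ν (u, Δw) + ∫ (u ⊗ u) : ∇w`
(`Torus.nsGeneratorPairing ν f u w`) is `μ`-integrable with `∫ ⟨F(u), w⟩ dμ = 0`.

Proof. `μ` is carried by the support ball `|u| ≤ ‖f‖₂ / (4π²ν)`
(`IsStationaryStatisticalSolution.ae_norm_le`), on which, by Cauchy–Schwarz
(`Torus.abs_pairing_coe_le`), `|(u, w)| ≤ |u| ‖w‖₂ < R := ‖f‖₂ ‖w‖₂ / (4π²ν) + 1`. The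
cylindrical functional `Φ` with the single coordinate `(·, w)` and profile `y ↦ y₀ χ(y)`, `χ` a
smooth bump `≡ 1` on the closed `R`-ball (`exists_cylindricalTest_grad_eq_of_lt`), has
`Φ'(u) = w` whenever `|(u, w)| < R`, hence `μ`-a.e.; so `⟨F(u), Φ'(u)⟩ = ⟨F(u), w⟩` `μ`-a.e.
and the Liouville equation for `Φ` (field `generator`) transfers along this a.e. equality.

References: Foias–Manley–Rosa–Temam, *Navier–Stokes Equations and Turbulence* (2001), Ch. IV
§1.2, Def. 1.3 and (1.30), (1.34).
-/

noncomputable section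

set_option linter.dupNamespace false

namespace Summit.AnomalousDissipation.AnomalousDissipation.Theorems.TaylorCertificatesFloorCertificateEnsembleCeiling

open MeasureTheory Filter Topology
open scoped InnerProductSpace ENNReal
open Literature.Analysis.FunctionSpaces Literature.Analysis.FluidPDE

/-- Local notation: real vector fields on `T³`. -/
local notation "Vec3" => (UnitAddTorus (Fin 3)) → (EuclideanSpace ℝ (Fin 3))
/-- Local notation: `L²(T³; ℝ³)`. -/
local notation "L2" => (Lp (EuclideanSpace ℝ (Fin 3)) 2 (volume : Measure (UnitAddTorus (Fin 3))))
/-- Local notation: the energy space `H`. -/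
local notation "H3" => (Torus.energySpace (Fin 3))

/-! ## A cylindrical functional whose differential is a given field on a ball -/

-- adapted from Cruxes/FloorCertificateEnsembleCeiling/Disproof.lean (`exists_cylindrical_grad_eq`)
/-- **A cylindrical functional whose differential is a GIVEN test field on a ball.** For `w ∈ 𝒱`
and `R > 0` there is a cylindrical `Φ` (one coordinate `(·, w)`, profile `y ↦ y₀ χ(y)` with `χ` a
smooth bump `≡ 1` on the closed `R`-ball) with `Φ'(u) = w` whenever `|(u, w)| < R`. -/
theorem exists_cylindricalTest_grad_eq_of_lt {w : Vec3} (hw : Torus.IsSmooth w)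
    (hdw : Torus.IsDivFree w) (hzw : Torus.HasZeroMean w) {R : ℝ} (hR : 0 < R) :
    ∃ Φ : Torus.CylindricalTest (Fin 3), ∀ u : H3,
      |Torus.pairing (u : L2) w| < R → Φ.grad u = w := by
  let χ : ContDiffBump (0 : EuclideanSpace ℝ (Fin 1)) := ⟨R, R + 1, hR, by linarith⟩
  set a : EuclideanSpace ℝ (Fin 1) → ℝ := fun y => EuclideanSpace.proj (𝕜 := ℝ) (0 : Fin 1) y with ha
  have ha_diff : ContDiff ℝ 1 a := (EuclideanSpace.proj (𝕜 := ℝ) (0 : Fin 1)).contDiff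
  have hχ_diff : ContDiff ℝ 1 (χ : EuclideanSpace ℝ (Fin 1) → ℝ) := χ.contDiff
  let Φ : Torus.CylindricalTest (Fin 3) :=
    { m := 1
      g := fun _ => w
      g_smooth := fun _ => hw
      g_divFree := fun _ => hdw
      g_zeroMean := fun _ => hzw
      φ := fun y => a y * χ y
      φ_contDiff := ha_diff.mul hχ_diff
      φ_compact := χ.hasCompactSupport.mul_left }
  refine ⟨Φ, fun u hu => ?_⟩
  set y₀ : EuclideanSpace ℝ (Fin 1) := Φ.coords u with hy₀
  have hy₀c : y₀ = WithLp.toLp 2 (fun _ : Fin 1 => Torus.pairing (u : L2) w) := rfl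
  -- `y₀` lies in the open `R`-ball
  have hball : y₀ ∈ Metric.ball (0 : EuclideanSpace ℝ (Fin 1)) χ.rIn := by
    rw [Metric.mem_ball, dist_zero_right, hy₀c, EuclideanSpace.norm_eq]
    simp only [Fin.sum_univ_one, Real.norm_eq_abs, sq_abs]
    rw [Real.sqrt_sq_eq_abs]
    exact hu
  have hχ1 : (χ : EuclideanSpace ℝ (Fin 1) → ℝ) y₀ = 1 :=
    χ.one_of_mem_closedBall (Metric.ball_subset_closedBall hball)
  have hχ' : _root_.fderiv ℝ (χ : EuclideanSpace ℝ (Fin 1) → ℝ) y₀ = 0 := by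
    rw [(χ.eventuallyEq_one_of_mem_ball hball).fderiv_eq]
    exact fderiv_const_apply (1 : ℝ)
  have hderiv : _root_.fderiv ℝ Φ.φ (Φ.coords u) (EuclideanSpace.single (0 : Fin 1) (1 : ℝ)) = 1 := by
    rw [← hy₀]
    change _root_.fderiv ℝ (fun y => a y * χ y) y₀ (EuclideanSpace.single (0 : Fin 1) (1 : ℝ)) = 1
    have hfun : (fun y => a y * (χ : EuclideanSpace ℝ (Fin 1) → ℝ) y) =
        a * (χ : EuclideanSpace ℝ (Fin 1) → ℝ) := rfl
    rw [hfun, fderiv_mul (ha_diff.differentiable one_ne_zero y₀)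
      (hχ_diff.differentiable one_ne_zero y₀), hχ1, hχ', smul_zero, zero_add, one_smul]
    rw [ha, ContinuousLinearMap.fderiv]
    simp
  funext x
  change ∑ i : Fin 1, (_root_.fderiv ℝ Φ.φ (Φ.coords u) (EuclideanSpace.single i 1)) • Φ.g i x = w x
  rw [Fin.sum_univ_one, hderiv, one_smul]

/-! ## The Liouville equation tested with a fixed field -/

/-- **D `stub_linearLiouville`** — THE LIOUVILLE EQUATION TESTED WITH A FIXED FIELD. For `ν > 0`,
`f ∈ L²`, a smooth solenoidal mean-zero test field `w` and a stationary statistical solution `μ`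
of `NS_ν(f)` (FMRT IV Def. 1.3): `u ↦ ⟨F(u), w⟩ = (f,w) + ν(u,Δw) + ∫(u⊗u):∇w` is `μ`-integrable
and `∫ ⟨F(u), w⟩ dμ = 0`. Proof: `μ` is carried by the support ball `|u| ≤ ‖f‖₂/(4π²ν)`
(`IsStationaryStatisticalSolution.ae_norm_le`), on which `|(u, w)| < R := ‖f‖₂‖w‖₂/(4π²ν) + 1`
(`Torus.abs_pairing_coe_le`); the cylindrical functional of `exists_cylindricalTest_grad_eq_of_lt`
has `Φ'(u) = w` there, so `⟨F(u), Φ'(u)⟩ = ⟨F(u), w⟩` `μ`-a.e.; conclude with `hμ.generator Φ`. -/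
theorem stub_linearLiouville :
    ∀ (ν : ℝ) (f w : Vec3) (μ : Measure H3), 0 < ν → MemLp f 2 volume →
      Torus.IsSmooth w → Torus.IsDivFree w → Torus.HasZeroMean w →
      Torus.IsStationaryStatisticalSolution ν f μ →
      Integrable (fun u : H3 => Torus.nsGeneratorPairing ν f u w) μ ∧
        ∫ u, Torus.nsGeneratorPairing ν f u w ∂μ = 0 := by
  intro ν f w μ hν hf hw hdw hzw hμ
  have hw2 : MemLp w 2 volume := hw.memLp 2
  set F : ℝ := ‖hf.toLp f‖ with hF
  set W : ℝ := ‖hw2.toLp w‖ with hW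
  have hW0 : 0 ≤ W := norm_nonneg _
  -- the localising cylindrical functional
  set R : ℝ := F / (4 * Real.pi ^ 2 * ν) * W + 1 with hR
  have hR0 : 0 < R := by positivity
  obtain ⟨Φ, hΦ⟩ := exists_cylindricalTest_grad_eq_of_lt hw hdw hzw hR0
  have hgrad : ∀ᵐ u ∂μ, Φ.grad u = w := by
    filter_upwards [hμ.ae_norm_le hν hf] with u hu
    refine hΦ u ?_
    calc |Torus.pairing (u : L2) w| ≤ ‖u‖ * W := Torus.abs_pairing_coe_le hw2 u
      _ ≤ F / (4 * Real.pi ^ 2 * ν) * W := mul_le_mul_of_nonneg_right hu hW0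
      _ < R := by rw [hR]; linarith
  -- the Liouville equation with `Φ' = w` a.e.
  obtain ⟨hGint, hG0⟩ := hμ.generator Φ
  have hae : (fun u => Torus.nsGeneratorPairing ν f u (Φ.grad u)) =ᵐ[μ]
      (fun u : H3 => Torus.nsGeneratorPairing ν f u w) := by
    filter_upwards [hgrad] with u hu
    rw [hu]
  refine ⟨hGint.congr hae, ?_⟩
  rw [← integral_congr_ae hae]
  exact hG0

end Summit.AnomalousDissipation.AnomalousDissipation.Theorems.TaylorCertificatesFloorCertificateEnsembleCeiling
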